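import Literature.Analysis.FluidPDE.ClassicalSolutionRescale
import Literature.Analysis.FluidPDE.ClassicalSolutionRegion
import Literature.Analysis.FluidPDE.LocalAffineChainRules
import HarnessLib

/-!
# Space–time rescaling of classical Navier–Stokes solutions on an open region

Analysis/FluidPDE support file (theorems only). `ClassicalSolutionRescale.lean` proves the
covariance of *slab* classical solutions `IsClassicalNSSolutionOn S ν f u p` (fields smooth on
`S × E`) under the affine space–time maps `Φ(s, y) = (t₀ + β s, x₀ + γ y)`
(`IsClassicalNSSolutionOn.stRescale`). Local regularity theory needs the same statement for
solutions that are classical only on an **open space–time region** `Ω`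
(`IsClassicalNSSolutionOnRegion`, `ClassicalSolutionRegion.lean`: parabolic cylinders of
ε-regularity and local-analyticity theorems, e.g. Bradshaw–Grujić–Kukavica 2015, Thm. 2.3).
Here:

* `IsClassicalNSSolutionOnRegion.stRescale_of_isOpen` — if `(u, p)` is a classical solution with
  viscosity `ν` and force `f` on an open region `Ω`, then for `α, γ > 0`, `β = αγ`, the pair
  `(α • u ∘ Φ, α² • p ∘ Φ)` is a classical solution with viscosity `αν/γ` and force
  `α²γ • f ∘ Φ` on the open region `Φ⁻¹(Ω)` (the Laplacian of a slice that is `C²` only on an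
  open set is handled by `laplacian_comp_affine_of_contDiffOn`);
* `IsClassicalNSSolutionOnRegion.nsRescale_translate_of_isOpen` — the parabolic zoom
  `u ↦ c u(t₀ + c²s, x₀ + c y)`, `p ↦ c² p(t₀ + c²s, x₀ + c y)` at fixed viscosity
  (`α = γ = c`, `β = c²`), the form used to normalise a space–time point and a scale;
* `stAffine_preimage_prod` — `Φ⁻¹(S ×ˢ D) = {s | t₀ + βs ∈ S} ×ˢ {y | x₀ + γy ∈ D}`.

## Mathlib / tree search

Tree: `IsClassicalNSSolutionOn.stRescale` (slab version, the model of the proof),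
`timeDeriv_stPull`, `fderiv_stPull`, `convect_stPull`, `gradient_stPull`, `divergence_stPull`,
`contDiff_stAffine`, `continuous_stAffine` (`SpaceTimeRescaling.lean`),
`laplacian_comp_affine_of_contDiffOn` (`LocalAffineChainRules.lean`),
`isClassicalNSSolutionOnRegion_iff_of_isOpen`, `contDiffOn_spaceSection`
(`ClassicalSolutionRegion.lean`), `gradient_const_smul` (`NSViscosityRescaling.lean`),
`divergence_const_smul_apply` (`PressurePoisson.lean`). Mathlib: `deriv_fun_const_smul_field`,
`fderiv_fun_const_smul`, `InnerProductSpace.laplacian_smul`.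

## References

* J. Leray, Acta Math. 63 (1934), §20 (the similarity transformation). [Leray1934]
* L. Caffarelli, R. Kohn, L. Nirenberg, Comm. Pure Appl. Math. 35 (1982), (1.5)–(1.6) (scaling
  of local solutions on parabolic cylinders). [CaffarelliKohnNirenberg1982]
-/

noncomputable section

open Set Function Filter Metric
open _root_.Topology
open scoped Laplacian ContDiff Pointwise

namespace Literature.Analysis.FluidPDE

variable {E : Type*} [NormedAddCommGroup E] [InnerProductSpace ℝ E] [FiniteDimensional ℝ E]

omit [FiniteDimensional ℝ E] in
/-- Preimage of a space–time cylinder `S ×ˢ D` under `Φ(s, y) = (t₀ + βs, x₀ + γy)`. [folklore] -/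
theorem stAffine_preimage_prod (β γ t₀ : ℝ) (x₀ : E) (S : Set ℝ) (D : Set E) :
    stAffine β γ t₀ x₀ ⁻¹' (S ×ˢ D) =
      ((fun s => t₀ + β * s) ⁻¹' S) ×ˢ ((fun y => x₀ + γ • y) ⁻¹' D) := by
  ext ⟨s, y⟩
  simp [stAffine_apply, mem_prod]

omit [FiniteDimensional ℝ E] in
/-- The space section of `Φ⁻¹(Ω)` at time `s` is the preimage of the space section of `Ω` at
time `t₀ + βs` under `y ↦ x₀ + γy`. [folklore] -/
theorem spaceSection_preimage_stAffine (β γ t₀ : ℝ) (x₀ : E) (Ω : Set (ℝ × E)) (s : ℝ) :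
    spaceSection (stAffine β γ t₀ x₀ ⁻¹' Ω) s =
      (fun y => x₀ + γ • y) ⁻¹' spaceSection Ω (t₀ + β * s) := by
  ext y
  simp [mem_spaceSection, stAffine_apply]

/-- **Space–time rescaling of classical solutions on an open region.** If `(u, p)` is a classical
Navier–Stokes solution with viscosity `ν` and force `f` on the open region `Ω ⊆ ℝ × E`, then for
`α, γ > 0` and `β = αγ` the rescaled pair `(α • u ∘ Φ, α² • p ∘ Φ)`,
`Φ(s, y) = (t₀ + βs, x₀ + γy)`, is a classical solution with viscosity `αν/γ` and force
`α²γ • f ∘ Φ` on the open region `Φ⁻¹(Ω)`: every term of the momentum equation at `(s, y)` is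
`α²γ` times the corresponding term at `Φ(s, y)` (Leray 1934, §20; CKN 1982, (1.5)–(1.6)).
[cite: Leray1934, §20] -/
theorem IsClassicalNSSolutionOnRegion.stRescale_of_isOpen {Ω : Set (ℝ × E)} {ν : ℝ}
    {f u : ℝ → E → E} {p : ℝ → E → ℝ} (h : IsClassicalNSSolutionOnRegion Ω ν f u p)
    (hΩ : IsOpen Ω) {α β γ : ℝ} (hα : 0 < α) (hγ : 0 < γ) (hβ : β = α * γ) (t₀ : ℝ) (x₀ : E) :
    IsClassicalNSSolutionOnRegion (stAffine β γ t₀ x₀ ⁻¹' Ω) (α * ν / γ)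
      ((α ^ 2 * γ) • stPull β γ t₀ x₀ f) (α • stPull β γ t₀ x₀ u)
      (α ^ 2 • stPull β γ t₀ x₀ p) := by
  have hΩ' : IsOpen (stAffine β γ t₀ x₀ ⁻¹' Ω) := hΩ.preimage (continuous_stAffine β γ t₀ x₀)
  have hβ0 : β ≠ 0 := by rw [hβ]; positivity
  obtain ⟨hu, hp, hmom, hdiv⟩ := (isClassicalNSSolutionOnRegion_iff_of_isOpen hΩ).1 h
  rw [isClassicalNSSolutionOnRegion_iff_of_isOpen hΩ']
  have hmaps : MapsTo (stAffine β γ t₀ x₀) (stAffine β γ t₀ x₀ ⁻¹' Ω) Ω := mapsTo_preimage _ _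
  have haff : ContDiff ℝ ∞ (stAffine β γ t₀ x₀) := contDiff_stAffine β γ t₀ x₀
  refine ⟨?_, ?_, fun s y hsy => ?_, fun s y hsy => ?_⟩
  · have h1 : uncurry (α • stPull β γ t₀ x₀ u) =
        fun z => α • (uncurry u ∘ stAffine β γ t₀ x₀) z := by
      funext z; rfl
    rw [h1]
    exact (hu.comp haff.contDiffOn hmaps).const_smul α
  · have h1 : uncurry (α ^ 2 • stPull β γ t₀ x₀ p) =
        fun z => α ^ 2 • (uncurry p ∘ stAffine β γ t₀ x₀) z := by
      funext z; rfl
    rw [h1]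
    exact (hp.comp haff.contDiffOn hmaps).const_smul (α ^ 2)
  · -- the momentum equation at `(s, y)`, image point `(t, x) = Φ(s, y) ∈ Ω`
    have htx : (t₀ + β * s, x₀ + γ • y) ∈ Ω := hsy
    have hmom' := hmom _ _ htx
    -- smoothness of the slices at the image point
    have hOt : IsOpen (spaceSection Ω (t₀ + β * s)) := isOpen_spaceSection hΩ _
    have hxsec : x₀ + γ • y ∈ spaceSection Ω (t₀ + β * s) := htx
    have hu2 : ContDiffOn ℝ 2 (u (t₀ + β * s)) (spaceSection Ω (t₀ + β * s)) :=
      (contDiffOn_spaceSection hu _).of_le (by norm_cast)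
    have hp1 : ContDiffOn ℝ 1 (p (t₀ + β * s)) (spaceSection Ω (t₀ + β * s)) :=
      (contDiffOn_spaceSection hp _).of_le (by norm_cast)
    have hud' : DifferentiableAt ℝ (u (t₀ + β * s)) (x₀ + γ • y) :=
      (hu2.differentiableOn (by norm_num)).differentiableAt (hOt.mem_nhds hxsec)
    have hpd' : DifferentiableAt ℝ (p (t₀ + β * s)) (x₀ + γ • y) :=
      (hp1.differentiableOn (by norm_num)).differentiableAt (hOt.mem_nhds hxsec)
    have haffy : DifferentiableAt ℝ (fun z : E => x₀ + γ • z) y :=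
      ((differentiableAt_const _).add (differentiableAt_id.const_smul γ))
    have hud : DifferentiableAt ℝ (stPull β γ t₀ x₀ u s) y := by
      have : stPull β γ t₀ x₀ u s = u (t₀ + β * s) ∘ fun z : E => x₀ + γ • z := by
        funext z; rfl
      rw [this]
      exact hud'.comp y haffy
    have hpd : DifferentiableAt ℝ (stPull β γ t₀ x₀ p s) y := by
      have : stPull β γ t₀ x₀ p s = p (t₀ + β * s) ∘ fun z : E => x₀ + γ • z := by
        funext z; rfl
      rw [this]
      exact hpd'.comp y haffy
    have hu2at : ContDiffAt ℝ 2 (stPull β γ t₀ x₀ u s) y := by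
      have : stPull β γ t₀ x₀ u s = u (t₀ + β * s) ∘ fun z : E => x₀ + γ • z := by
        funext z; rfl
      rw [this]
      exact (hu2.contDiffAt (hOt.mem_nhds hxsec)).comp y
        ((contDiff_const.add (contDiff_id.const_smul γ)).contDiffAt)
    -- time derivative
    have htime : deriv (fun r => (α • stPull β γ t₀ x₀ u) r y) s =
        (α * β) • deriv (fun r => u r (x₀ + γ • y)) (t₀ + β * s) := by
      have e1 : (fun r => (α • stPull β γ t₀ x₀ u) r y) =
          fun r => α • stPull β γ t₀ x₀ u r y := rfl
      rw [e1, deriv_fun_const_smul_field, ← timeDeriv_apply (stPull β γ t₀ x₀ u) s y,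
        timeDeriv_stPull, timeDeriv_apply, smul_smul]
    rw [htime]
    -- convective term
    have hconv : convect ((α • stPull β γ t₀ x₀ u) s) ((α • stPull β γ t₀ x₀ u) s) y =
        (α ^ 2 * γ) • convect (u (t₀ + β * s)) (u (t₀ + β * s)) (x₀ + γ • y) := by
      rw [convect_apply, show (α • stPull β γ t₀ x₀ u) s = α • stPull β γ t₀ x₀ u s from rfl,
        fderiv_const_smul hud, FunLike.coe_smul, Pi.smul_apply, Pi.smul_apply,
        map_smul, ← convect_apply, convect_stPull, convect_apply, stPull_apply, smul_smul,
        smul_smul]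
      congr 1
      ring
    rw [hconv]
    -- Laplacian (local chain rule: the slice is `C²` on the open space section only)
    have hlap : (Δ ((α • stPull β γ t₀ x₀ u) s)) y =
        (α * γ ^ 2) • (Δ (u (t₀ + β * s))) (x₀ + γ • y) := by
      rw [show (α • stPull β γ t₀ x₀ u) s = α • stPull β γ t₀ x₀ u s from rfl,
        InnerProductSpace.laplacian_smul α hu2at]
      have e2 : stPull β γ t₀ x₀ u s = fun z => u (t₀ + β * s) (x₀ + γ • z) := by
        funext z; rfl
      rw [e2, laplacian_comp_affine_of_contDiffOn hu2 hOt x₀ γ hxsec, smul_smul]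
    rw [hlap]
    -- pressure gradient
    have hgrad : gradient ((α ^ 2 • stPull β γ t₀ x₀ p) s) y =
        (α ^ 2 * γ) • gradient (p (t₀ + β * s)) (x₀ + γ • y) := by
      rw [show (α ^ 2 • stPull β γ t₀ x₀ p) s = fun z => (α ^ 2) • stPull β γ t₀ x₀ p s z
        from rfl, gradient_const_smul hpd, gradient_stPull, smul_smul]
    rw [hgrad]
    -- assemble
    have key : (α ^ 2 * γ) • (deriv (fun r => u r (x₀ + γ • y)) (t₀ + β * s) +
        convect (u (t₀ + β * s)) (u (t₀ + β * s)) (x₀ + γ • y)) =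
        (α ^ 2 * γ) • (ν • (Δ (u (t₀ + β * s))) (x₀ + γ • y) -
          gradient (p (t₀ + β * s)) (x₀ + γ • y) + f (t₀ + β * s) (x₀ + γ • y)) := by
      rw [hmom']
    rw [smul_add] at key
    have e1 : (α * β) • deriv (fun r => u r (x₀ + γ • y)) (t₀ + β * s) =
        (α ^ 2 * γ) • deriv (fun r => u r (x₀ + γ • y)) (t₀ + β * s) := by
      rw [hβ]; congr 1; ring
    rw [e1, key, smul_add, smul_sub, smul_smul, smul_smul]
    simp only [Pi.smul_apply, stPull_apply]
    congr 2
    field_simp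
  · have htx : (t₀ + β * s, x₀ + γ • y) ∈ Ω := hsy
    have hOt : IsOpen (spaceSection Ω (t₀ + β * s)) := isOpen_spaceSection hΩ _
    have hxsec : x₀ + γ • y ∈ spaceSection Ω (t₀ + β * s) := htx
    have hu1 : ContDiffOn ℝ 1 (u (t₀ + β * s)) (spaceSection Ω (t₀ + β * s)) :=
      (contDiffOn_spaceSection hu _).of_le (by norm_cast)
    have hud' : DifferentiableAt ℝ (u (t₀ + β * s)) (x₀ + γ • y) :=
      (hu1.differentiableOn (by norm_num)).differentiableAt (hOt.mem_nhds hxsec)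
    have hd : DifferentiableAt ℝ (stPull β γ t₀ x₀ u s) y := by
      have : stPull β γ t₀ x₀ u s = u (t₀ + β * s) ∘ fun z : E => x₀ + γ • z := by
        funext z; rfl
      rw [this]
      exact hud'.comp y ((differentiableAt_const _).add (differentiableAt_id.const_smul γ))
    rw [show (α • stPull β γ t₀ x₀ u) s = fun z => α • stPull β γ t₀ x₀ u s z from rfl,
      divergence_const_smul_apply hd, divergence_stPull, hdiv _ _ htx, mul_zero, mul_zero]

/-- **The parabolic zoom of a classical solution on an open region** (Leray 1934, §20; KNSS 2009,
(6.2)): at fixed viscosity `ν`, `(c u(t₀ + c²s, x₀ + c y), c² p(t₀ + c²s, x₀ + c y))` is a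
classical solution with force `c³ f(t₀ + c²s, x₀ + cy)` on `Φ⁻¹(Ω)`, `Φ(s,y) = (t₀ + c²s, x₀ + cy)`,
`c > 0`. [cite: Leray1934, §20] -/
theorem IsClassicalNSSolutionOnRegion.nsRescale_translate_of_isOpen {Ω : Set (ℝ × E)} {ν : ℝ}
    {f u : ℝ → E → E} {p : ℝ → E → ℝ} (h : IsClassicalNSSolutionOnRegion Ω ν f u p)
    (hΩ : IsOpen Ω) {c : ℝ} (hc : 0 < c) (t₀ : ℝ) (x₀ : E) :
    IsClassicalNSSolutionOnRegion (stAffine (c ^ 2) c t₀ x₀ ⁻¹' Ω) ν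
      ((c ^ 2 * c) • stPull (c ^ 2) c t₀ x₀ f) (c • stPull (c ^ 2) c t₀ x₀ u)
      (c ^ 2 • stPull (c ^ 2) c t₀ x₀ p) := by
  have key := h.stRescale_of_isOpen hΩ hc hc (show c ^ 2 = c * c from sq c) t₀ x₀
  have hν : c * ν / c = ν := by field_simp
  rwa [hν] at key

end Literature.Analysis.FluidPDE

end
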